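import Summits.QuantumFields.YangMills.Theorems.FluctuationComparisonRegPrIntLS2BetaRelativeWordStokes
import Summits.QuantumFields.YangMills.Theorems.FluctuationComparisonRegPrIntLS2BetaCorrLetterL2
import Summits.QuantumFields.YangMills.Theorems.FluctuationComparisonRegPrIntLS2BetaBondNeighbourhoodKernel
import Summits.QuantumFields.YangMills.Theorems.FluctuationComparisonRegPrIntLS2BetaExpMeanLogLipschitz
import Summits.QuantumFields.YangMills.Theorems.FluctuationComparisonRegPrIntLS2BetaKeyLemmaSkeleton
import HarnessLib

/-!
# F4-rel «corr-rel» — THE TWO-FIELD CORRECTION-FACTOR LETTER IN ℓ² (UV3-NODE §84.4 (H♭)(iii)), FILE B: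
# `‖dist1 (κ(U₀)⁻¹·κ(U))‖_{ℓ²(coarse bonds)} ≤ C₁(L,d)·‖δ(U,U₀)‖_{ℓ²(fine plaquettes)} + C₂(L,d)·θ·‖dev(U,U₀)‖_{ℓ²(fine bonds)}`, one level —
# the relative edition of px21 g21's F4 ✓p817406 `…S2BetaCorrLetterL2`
# (crux `FluctuationComparisonRegPrIntL`, stmt-QuantumFields-20520; registry v11.4 `Cruxes/FluctuationComparisonRegPrIntL/Lines/semiclassical_s2beta.lean` 3732b7df FROZEN, untouched)

Cell `ym3-torus` (YM ladder rung R3 = continuum `SU(2)` Yang–Mills on the three-torus — a RUNG: NOT d = 4, NOT infinite volume, NOT a mass gap, NOT Clay).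
Width seat «width 21» `ym3-torus-px21` (gen 23), FREE px helper; `--kind proof --supports stmt-QuantumFields-20520 --as helper`, count-neutral, DEFINITION-FREE
(0 `def`, 0 `instance`, 0 `notation`, 0 `sorry`; ONE declaration carries a decl-local `set_option maxHeartbeats 400000 in` per the cell's CI-cliff rule —
w8 g21's hb-100k twin timed out on it at 100k and passed at 160k; no `simp`∕`decide` search, only term size).

WHERE IT DOCKS.  px12 g24's REL-TEL dock ✓p822621 `…S2BetaRelGaugeOfRelativeLetter.dockRel_inner` reduces the registered stiffness organ's distance letter (D♮) to the
two-tower letter (L♭) ∧ (H♭); (H♭) bounds the relative flap `‖dist1 (P_j·P₀_j⁻¹)‖_{ℓ²}` of the two stage towers, and its SPINE rows read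
`T_c(U′)·T_c(V)⁻¹·(T_c(U′₀)·T_c(V₀)⁻¹)⁻¹ = κ_c(U′)⁻¹·κ_c(U′₀)` (✓(b3) `axialAvg_mul_avgFun_inv` twice; `V = lift ū(U′)` by (T5) + ✓`axialAvg_lift`) — the RELATIVE
correction factor of (0.4), `κ_c(U) = ℰ(W_{c,·}(U))`.  Its absolute edition is F4 ✓p817406 (`‖dist1 κ‖₂ ≤ C·‖dist1 U(∂·)‖₂`); UV3-NODE §84.4 (iii) named the
relative edition «corr-rel … S–M, un-held».  The currency is px10 g23's (✓p822074, UV3-NODE §82.1): `δ_q := dist1 (U₀(∂q)⁻¹·U(∂q))`, `dev_b := dist1 (U₀(b)⁻¹·U(b))`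
(`bdev`); EVERY right-hand term vanishes at `U = U₀`; the `θ`-weighted `dev` term is the SIZE × ARC junk of the commutator road — a SAME-LEVEL term with the small
coefficient `θ_j`, the «`+ c·θ_j·B_j`» of §84.4 (v), absorbed in (H♭)'s recursion by XS algebra.

ROUTE.  (R0) ✓p812922 `…S2BetaExpMeanLogLipschitz.dist1_avg_mul_inv_le_mean_lin` (px8 g21): on the guard `dist1 W_i, dist1 W′_i ≤ ρ < δ_N`,
`dist1 (ℰ.avg W′·(ℰ.avg W)⁻¹) ≤ (1 + 4ρ)·mean_i dist1 (W′_i·W_i⁻¹)` — the relative `exp∘mean∘log` Lipschitz letter IS in the tree; (R1) FILE A2 ✓`…S2BetaRelativeWordStokes.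
dist1_loopHol_rel_le_local`: every relative member loop `≤ K·[ε + 2θ·((K′+2)·η)]` (`K = ((d+2)L)²∕4`, `K′ = (d+2)L`) under LOCAL data on the three blocks; here
`ε :=` the neighbourhood SUM of `δ_q`, `η :=` the neighbourhood SUM of `dev_b` (single term `≤` sum — no `η ↓ 0` device needed); (R2) Schur to `ℓ²`: the bond-indexed
neighbourhood kernel for PLAQUETTES is F4's ✓`sqrt_sum_sq_le_of_le_bond_nbhd_sum`; for fine BONDS it is §1 here (rows px10 ✓`card_bond_filter_blockOf_mem_le`, columns
F4's ✓`card_filter_bond_src_mem_le`), + finite Minkowski (✓`…S2BetaKeyLemmaSkeleton.sqrt_sum_sq_le_of_le_add`).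

WHAT.  §1 `card_bond_nbhd3_le`, `card_cobond_bond_nbhd_le`, `bond_bond_nbhd_schur`, `sqrt_sum_sq_le_of_le_bond_bond_nbhd_sum` (the fine-BOND datum, coarse-BOND index);
§2 ★`dist1_loopHol_rel_le_nbhd_sum` (any `GaugeGroup` + commutator letter; `SU(N)` reading): relative member loops `≤ K·(Σ_{N(c₋)} δ_q) + 2θK(K′+2)·(Σ_{N_b(c₋)} dev_b)`;
§3 `corr_eq_avg_of_le`, ★`dist1_corr_rel_le_mean` (`SU(N)`: `dist1 (κ_c(U₀)⁻¹·κ_c(U)) ≤ (1 + 4ρ)·mean_i dist1 (W_{c,i}(U₀)⁻¹·W_{c,i}(U))` on the guard), ★★`dist1_corr_rel_le_nbhd_sum`;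
§4 ★★★`sqrt_sum_dist1_corr_rel_sq_le` — THE LETTER: under `PlaqSmall θ U` (SIZE), `PlaqSmall θ₀ U₀` (guard), `K·θ, K·θ₀ < δ_N`:
`√(Σ_c dist1 (κ_c(U₀)⁻¹·κ_c(U))²) ≤ 3K·√((3^dL^dd²)(3^dd))·√(Σ_q δ_q²) + (3K·(2θ(K′+2)))·√((3^dL^dd)(3^dd))·√(Σ_b dev_b²)`; §5 ★★★`sqrt_sum_dist1_spine_rel_sq_le` — the
SPINE edition (two `havg` binders, both orientations `dist1 (X·X₀⁻¹)` ∕ `dist1 (X₀⁻¹·X)`).  Constants polynomial in `L` (they land in (H♭)'s `C`, not in its `√L`).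

HONEST: finite combinatorics on the `Setup` torus over three cited one-level estimates (✓p812922, FILE A2, F4 §1); crude constants; nothing of Bałaban's analysis is
asserted; (H♭) (its field-letter and key-lemma halves), (L♭)'s sup-profile edition, the WLOG suppliers, (D♮), (F♮), `hIrr`∕`hA`, GAP♯∘ (`stub_uniformFibreGapOrbit`),
S2β, the five registered stubs (0∕5), crux 20520, 19936, 19200 and `YM3TorusSU2` are NOT proved; no registered stub is closed; rung R3 = SU(2) YM₃ on T³ — NOT d = 4,
NOT infinite volume, NOT a mass gap, NOT Clay; the Yang–Mills mass gap is NOT proved.  Sorry-free, axioms standard.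
References: T. Bałaban, CMP **109** (1987) 249–301 [Balaban1987RG1] ((0.3)–(0.7) pp.252–253); CMP **98** (1985) 17–51 [Balaban1985Averaging] ((19)–(21) pp.21–22,
(26)–(27) p.22); CMP **99** (1985) 75–102 [Balaban1985RegularSpaces] (Lemma 1 p.79: relative in gauge, absolute in size — px10 §82.4; the relative-size edition
is this line's device).
-/

set_option autoImplicit false

noncomputable section

namespace Summit.QuantumFields.YangMills.Theorems.FluctuationComparisonRegPrIntLS2BetaCorrLetterL2Relative

open Finset
open Literature.MathematicalPhysics.QuantumFieldTheory.Balaban1983to89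
open Literature.MathematicalPhysics.QuantumFieldTheory.Balaban1983to89.T4Continuum
open Literature.MathematicalPhysics.QuantumFieldTheory.Balaban1983to89.BlockAveraging
open Literature.MathematicalPhysics.QuantumFieldTheory.Balaban1983to89.ExpMeanLog (deltaSU expMeanLogSU lt_third_of_lt_deltaSU)
open T4TiltOscillation (bdev)
open Summit.QuantumFields.YangMills.Theorems.FluctuationComparisonRegPrIntLS2BetaSchurTest (schur_test_sq)
open Summit.QuantumFields.YangMills.Theorems.FluctuationComparisonRegPrIntLS2BetaNeighbourhoodKernelTorus (near_symm card_near_le)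
open Summit.QuantumFields.YangMills.Theorems.FluctuationComparisonRegPrIntLS2BetaBondNeighbourhoodKernel (card_bond_filter_blockOf_mem_le)
open Summit.QuantumFields.YangMills.Theorems.FluctuationComparisonRegPrIntLS2BetaCorrLetterL2
  (card_filter_bond_src_mem_le sqrt_sum_sq_le_of_le_bond_nbhd_sum near_self near_shift near_unshift)
open Summit.QuantumFields.YangMills.Theorems.FluctuationComparisonRegPrIntLS2BetaExpMeanLogLipschitz (dist1_avg_mul_inv_le_mean_lin)
open Summit.QuantumFields.YangMills.Theorems.FluctuationComparisonRegPrIntLS2BetaKeyLemmaSkeleton (sqrt_sum_sq_le_of_le_add)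
open Summit.QuantumFields.YangMills.Theorems.FluctuationComparisonRegPrIntLS2BetaRelativeStokes (dist1_comm_le_SU dist1_mul_inv_eq_rel dist1_rel_comm)
open Summit.QuantumFields.YangMills.Theorems.FluctuationComparisonRegPrIntLS2BetaRelativeWordStokes (dist1_loopHol_rel_le_local)
open Summit.QuantumFields.YangMills.Theorems.FluctuationComparisonRegPrIntLS2BetaOneStepMeanLetter (axialAvg_mul_avgFun_inv)

variable {P : Params} {j k : ℕ}

/-! ## §1 The neighbourhood kernel with a fine-BOND datum, indexed by coarse BONDS: row and column counts, Schur, the `hj` shape -/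

/-- **ROW COUNT**: `#{b : PBond_j | blockOf b₋ near y} ≤ 3^d·L^d·d` (px10 ✓`card_bond_filter_blockOf_mem_le` with the `3^d` near set of ✓`card_near_le`; standing range).
[cite: Balaban1987RG1, (0.3) p.252] -/
theorem card_bond_nbhd3_le (hj : j + 1 ≤ P.m + P.K) (y : Site P (j + 1)) :
    (Finset.univ.filter (fun b : PBond P j => ∀ κ, blockOf b.src κ = y κ ∨ blockOf b.src κ = y κ + 1 ∨ blockOf b.src κ = y κ - 1)).card ≤
      3 ^ P.d * P.L ^ P.d * P.d := by
  classical
  set S := Finset.univ.filter (fun z : Site P (j + 1) => ∀ κ, z κ = y κ ∨ z κ = y κ + 1 ∨ z κ = y κ - 1) with hS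
  have hsub : Finset.univ.filter (fun b : PBond P j => ∀ κ, blockOf b.src κ = y κ ∨ blockOf b.src κ = y κ + 1 ∨ blockOf b.src κ = y κ - 1) ⊆
      Finset.univ.filter (fun b : PBond P j => blockOf b.src ∈ S) := by
    intro b hb
    rw [Finset.mem_filter] at hb ⊢
    refine ⟨hb.1, ?_⟩
    rw [hS, Finset.mem_filter]
    exact ⟨Finset.mem_univ _, hb.2⟩
  exact (Finset.card_le_card hsub).trans
    ((card_bond_filter_blockOf_mem_le hj S).trans (Nat.mul_le_mul_right _ (Nat.mul_le_mul_right _ (card_near_le y))))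

/-- **COLUMN COUNT**: a fine bond `b` lies in the neighbourhood `N_b(c₋)` of at most `3^d·d` coarse bonds `c` (F4's ✓`card_cobond_nbhd_le` with `q₋` replaced by `b₋`).
[cite: Balaban1987RG1, (0.3) p.252] -/
theorem card_cobond_bond_nbhd_le (b : PBond P j) :
    (Finset.univ.filter (fun c : PBond P (j + 1) => ∀ κ, blockOf b.src κ = c.src κ ∨ blockOf b.src κ = c.src κ + 1 ∨
      blockOf b.src κ = c.src κ - 1)).card ≤ 3 ^ P.d * P.d := by
  classical
  set S := Finset.univ.filter (fun z : Site P (j + 1) => ∀ κ, z κ = blockOf b.src κ ∨ z κ = blockOf b.src κ + 1 ∨ z κ = blockOf b.src κ - 1)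
    with hS
  have hsub : Finset.univ.filter (fun c : PBond P (j + 1) => ∀ κ, blockOf b.src κ = c.src κ ∨ blockOf b.src κ = c.src κ + 1 ∨
      blockOf b.src κ = c.src κ - 1) ⊆ Finset.univ.filter (fun c : PBond P (j + 1) => c.src ∈ S) := by
    intro c hc
    rw [Finset.mem_filter] at hc ⊢
    refine ⟨hc.1, ?_⟩
    rw [hS, Finset.mem_filter]
    exact ⟨Finset.mem_univ _, near_symm hc.2⟩
  exact (Finset.card_le_card hsub).trans ((card_filter_bond_src_mem_le S).trans (Nat.mul_le_mul_right _ (card_near_le _)))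

/-- **SCHUR BOUND, fine-bond datum, coarse-bond index**: `Σ_{c : PBond_{j+1}} (Σ_{b ∈ N_b(c₋)} g b)² ≤ (3^d·L^d·d)·(3^d·d)·Σ_b g b²` (✓`schur_test_sq` with the indicator kernel).
[cite: Balaban1985Averaging, (19) p.21] -/
theorem bond_bond_nbhd_schur (hj : j + 1 ≤ P.m + P.K) (g : PBond P j → ℝ) :
    ∑ c : PBond P (j + 1), (∑ b ∈ Finset.univ.filter (fun b : PBond P j => ∀ κ, blockOf b.src κ = c.src κ ∨ blockOf b.src κ = c.src κ + 1 ∨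
        blockOf b.src κ = c.src κ - 1), g b) ^ 2 ≤
      ((3 ^ P.d * P.L ^ P.d * P.d : ℕ) : ℝ) * ((3 ^ P.d * P.d : ℕ) : ℝ) * ∑ b : PBond P j, g b ^ 2 := by
  classical
  have h := schur_test_sq (Finset.univ : Finset (PBond P (j + 1))) (Finset.univ : Finset (PBond P j))
    (fun c b => if (∀ κ, blockOf b.src κ = c.src κ ∨ blockOf b.src κ = c.src κ + 1 ∨ blockOf b.src κ = c.src κ - 1) then (1 : ℝ) else 0)
    (fun c _ b _ => by positivity) (R := ((3 ^ P.d * P.L ^ P.d * P.d : ℕ) : ℝ)) (C := ((3 ^ P.d * P.d : ℕ) : ℝ)) (by positivity)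
    (fun c _ => by
      rw [← Finset.sum_filter, Finset.sum_const, nsmul_eq_mul, mul_one]
      exact_mod_cast card_bond_nbhd3_le hj c.src)
    (fun b _ => by
      rw [← Finset.sum_filter, Finset.sum_const, nsmul_eq_mul, mul_one]
      exact_mod_cast card_cobond_bond_nbhd_le b) g
  simp only [ite_mul, one_mul, zero_mul, Finset.sum_ite, Finset.sum_const_zero, add_zero] at h
  convert h using 4

/-- **THE `hj` SHAPE, fine-bond datum**: a non-negative coarse-BOND function dominated by `c ×` the neighbourhood sum of a fine-BOND function has
`√(Σ_c J c²) ≤ c·√((3^d L^d d)(3^d d))·√(Σ_b g b²)`. [cite: Balaban1985Averaging, (19) p.21] -/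
theorem sqrt_sum_sq_le_of_le_bond_bond_nbhd_sum (hj : j + 1 ≤ P.m + P.K) (g : PBond P j → ℝ) (J : PBond P (j + 1) → ℝ) {c : ℝ} (hc : 0 ≤ c)
    (hJ0 : ∀ e, 0 ≤ J e)
    (hJ : ∀ e, J e ≤ c * ∑ b ∈ Finset.univ.filter (fun b : PBond P j => ∀ κ, blockOf b.src κ = e.src κ ∨ blockOf b.src κ = e.src κ + 1 ∨
        blockOf b.src κ = e.src κ - 1), g b) :
    √(∑ e : PBond P (j + 1), J e ^ 2) ≤
      c * √(((3 ^ P.d * P.L ^ P.d * P.d : ℕ) : ℝ) * ((3 ^ P.d * P.d : ℕ) : ℝ)) * √(∑ b : PBond P j, g b ^ 2) := by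
  have h1 : ∑ e : PBond P (j + 1), J e ^ 2 ≤ c ^ 2 * ∑ e : PBond P (j + 1), (∑ b ∈ Finset.univ.filter (fun b : PBond P j => ∀ κ,
      blockOf b.src κ = e.src κ ∨ blockOf b.src κ = e.src κ + 1 ∨ blockOf b.src κ = e.src κ - 1), g b) ^ 2 := by
    rw [Finset.mul_sum]
    refine Finset.sum_le_sum fun e _ => ?_
    rw [← mul_pow]
    exact pow_le_pow_left₀ (hJ0 e) (hJ e) 2
  have h2 := bond_bond_nbhd_schur hj g
  calc √(∑ e : PBond P (j + 1), J e ^ 2)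
      ≤ √(c ^ 2 * (((3 ^ P.d * P.L ^ P.d * P.d : ℕ) : ℝ) * ((3 ^ P.d * P.d : ℕ) : ℝ) * ∑ b : PBond P j, g b ^ 2)) :=
        Real.sqrt_le_sqrt (h1.trans (mul_le_mul_of_nonneg_left h2 (sq_nonneg c)))
    _ = c * √(((3 ^ P.d * P.L ^ P.d * P.d : ℕ) : ℝ) * ((3 ^ P.d * P.d : ℕ) : ℝ)) * √(∑ b : PBond P j, g b ^ 2) := by
        rw [Real.sqrt_mul (sq_nonneg c), Real.sqrt_sq hc, Real.sqrt_mul (by positivity)]; ring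

/-! ## §2 The relative member loops are bounded by the two neighbourhood SUMS — any gauge group + the commutator letter -/

section Loops

variable {G : Type*} [GaugeGroup G]

/-- ★ **EVERY RELATIVE (0.4) MEMBER LOOP IS BOUNDED BY THE NEIGHBOURHOOD SUMS** (standing range; any `GaugeGroup` carrying px10's commutator letter): under
`PlaqSmall θ U` (`0 ≤ θ`), for every coarse bond `c` and member index `i`,
`dist1 (W_{c,i}(U₀)⁻¹·W_{c,i}(U)) ≤ K·(Σ_{q ∈ N(c₋)} δ_q) + (K·(2θ·(K′ + 2)))·(Σ_{b ∈ N_b(c₋)} dev_b)`, `K = ((d+2)L)²∕4`, `K′ = (d+2)L`, `N(c₋)`∕`N_b(c₋)` = the fine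
plaquettes ∕ bonds based in blocks near `c₋` — FILE A2's local bound with `ε :=` the plaquette neighbourhood sum and `η :=` the bond neighbourhood sum (the three blocks
`c₋ − e_μ, c₋, c₊` of the loop word are near `c₋`: F4's ✓`near_unshift`∕`near_self`∕`near_shift`; a single non-negative term is `≤` the sum).
[cite: Balaban1987RG1, (0.4) p.253; Balaban1985Averaging, (19)-(20) p.21] -/
theorem dist1_loopHol_rel_le_nbhd_sum (hcomm : ∀ g h : G, dist1 (g * h * g⁻¹ * h⁻¹) ≤ 2 * dist1 g * dist1 h) (hj : j + 1 ≤ P.m + P.K)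
    (U U₀ : GaugeField P j G) {θ : ℝ} (hθ0 : 0 ≤ θ) (hU : PlaqSmall θ U) (c : PBond P (j + 1)) (i : Idx P) :
    dist1 ((loopHol U₀ c i)⁻¹ * loopHol U c i) ≤
      ((((P.d + 2) * P.L : ℕ) : ℝ) ^ 2 / 4) *
          ∑ q ∈ Finset.univ.filter (fun q : Plaq P j => ∀ κ, blockOf q.src κ = c.src κ ∨ blockOf q.src κ = c.src κ + 1 ∨
            blockOf q.src κ = c.src κ - 1), dist1 ((GaugeField.plaqHol U₀ q)⁻¹ * GaugeField.plaqHol U q) +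
        ((((P.d + 2) * P.L : ℕ) : ℝ) ^ 2 / 4 * (2 * θ * ((((P.d + 2) * P.L : ℕ) : ℝ) + 2))) *
          ∑ b ∈ Finset.univ.filter (fun b : PBond P j => ∀ κ, blockOf b.src κ = c.src κ ∨ blockOf b.src κ = c.src κ + 1 ∨
            blockOf b.src κ = c.src κ - 1), dist1 (bdev U U₀ b) := by
  classical
  set SP := ∑ q ∈ Finset.univ.filter (fun q : Plaq P j => ∀ κ, blockOf q.src κ = c.src κ ∨ blockOf q.src κ = c.src κ + 1 ∨
        blockOf q.src κ = c.src κ - 1), dist1 ((GaugeField.plaqHol U₀ q)⁻¹ * GaugeField.plaqHol U q) with hSP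
  set SB := ∑ b ∈ Finset.univ.filter (fun b : PBond P j => ∀ κ, blockOf b.src κ = c.src κ ∨ blockOf b.src κ = c.src κ + 1 ∨
        blockOf b.src κ = c.src κ - 1), dist1 (bdev U U₀ b) with hSB
  have hSP0 : 0 ≤ SP := Finset.sum_nonneg fun _ _ => GaugeGroup.dist1_nonneg _
  have hSB0 : 0 ≤ SB := Finset.sum_nonneg fun _ _ => GaugeGroup.dist1_nonneg _
  -- the three blocks of the loop word are near `c₋`
  have hnear : ∀ z : Site P j, (blockOf z = c.src.unshift c.dir ∨ blockOf z = c.src ∨ blockOf z = c.tgt) →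
      ∀ κ, blockOf z κ = c.src κ ∨ blockOf z κ = c.src κ + 1 ∨ blockOf z κ = c.src κ - 1 := by
    intro z hz
    rcases hz with hz | hz | hz <;> rw [hz]
    · exact near_unshift c.src c.dir
    · exact near_self c.src
    · exact near_shift c.src c.dir
  have hε : ∀ q : Plaq P j, (blockOf q.src = c.src.unshift c.dir ∨ blockOf q.src = c.src ∨ blockOf q.src = c.tgt) →
      dist1 ((GaugeField.plaqHol U₀ q)⁻¹ * GaugeField.plaqHol U q) ≤ SP := by
    intro q hq
    rw [hSP]
    exact Finset.single_le_sum (f := fun q : Plaq P j => dist1 ((GaugeField.plaqHol U₀ q)⁻¹ * GaugeField.plaqHol U q))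
      (fun _ _ => GaugeGroup.dist1_nonneg _) (Finset.mem_filter.mpr ⟨Finset.mem_univ _, hnear q.src hq⟩)
  have hη : ∀ b : PBond P j, (blockOf b.src = c.src.unshift c.dir ∨ blockOf b.src = c.src ∨ blockOf b.src = c.tgt) →
      dist1 (bdev U U₀ b) ≤ SB := by
    intro b hb
    rw [hSB]
    exact Finset.single_le_sum (f := fun b : PBond P j => dist1 (bdev U U₀ b))
      (fun _ _ => GaugeGroup.dist1_nonneg _) (Finset.mem_filter.mpr ⟨Finset.mem_univ _, hnear b.src hb⟩)
  have h := dist1_loopHol_rel_le_local U U₀ hcomm hθ0 hSP0 hSB0 hj c (fun q _ => hU q) hε hη i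
  refine h.trans (le_of_eq ?_)
  ring

end Loops

/-! ## §3 The relative correction factor at one bond: `SU(N)`, on the guard -/

section SUN

open scoped Matrix.Norms.L2Operator

variable {n : Type*} [Fintype n] [DecidableEq n] [Nonempty n]

/-- On the guard the correction factor IS the small-loop average of the member loops (`BlockAveraging.Small`; = the first lines of F4's ✓G12 `dist1_corr_le_mean`).
[cite: Balaban1987RG1, (0.4) p.253] -/
theorem corr_eq_avg_of_le (U : GaugeField P j (Matrix.specialUnitaryGroup n ℂ)) (c : PBond P (j + 1)) {ρ : ℝ}
    (hρ : ρ < deltaSU n) (hW : ∀ i, dist1 (loopHol U c i) ≤ ρ) :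
    corr (expMeanLogSU (n := n)) U c = (expMeanLogSU (n := n)).avg (loopHol U c) := by
  have hsmall : Small (expMeanLogSU (n := n)) U c := fun i => (hW i).trans_lt hρ
  unfold corr
  rw [if_pos hsmall]

/-- ★ **THE RELATIVE CORRECTION FACTOR IS CONTROLLED BY THE MEAN RELATIVE MEMBER LOOP**: if every member loop of `U` and of `U₀` at `c` is within `ρ < δ_N` of `1`, then
`dist1 (κ_c(U₀)⁻¹·κ_c(U)) ≤ (1 + 4ρ)·|Idx|⁻¹·Σ_i dist1 (W_{c,i}(U₀)⁻¹·W_{c,i}(U))` — both correction factors ARE the small-loop averages on the guard, then ✓p812922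
`dist1_avg_mul_inv_le_mean_lin` read with `dist1 (X·X₀⁻¹) = dist1 (X₀⁻¹·X)`. [cite: Balaban1987RG1, (0.4)-(0.7) p.253] -/
theorem dist1_corr_rel_le_mean (U U₀ : GaugeField P j (Matrix.specialUnitaryGroup n ℂ)) (c : PBond P (j + 1)) {ρ : ℝ}
    (hρ : ρ < deltaSU n) (hW : ∀ i, dist1 (loopHol U c i) ≤ ρ) (hW₀ : ∀ i, dist1 (loopHol U₀ c i) ≤ ρ) :
    dist1 ((corr (expMeanLogSU (n := n)) U₀ c)⁻¹ * corr (expMeanLogSU (n := n)) U c) ≤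
      (1 + 4 * ρ) * (((Fintype.card (Idx P) : ℝ))⁻¹ * ∑ i, dist1 ((loopHol U₀ c i)⁻¹ * loopHol U c i)) := by
  rw [corr_eq_avg_of_le U c hρ hW, corr_eq_avg_of_le U₀ c hρ hW₀, ← dist1_mul_inv_eq_rel]
  have h := dist1_avg_mul_inv_le_mean_lin (loopHol U₀ c) (loopHol U c) hρ hW₀ hW
  have e : ∀ i, dist1 (loopHol U c i * (loopHol U₀ c i)⁻¹) = dist1 ((loopHol U₀ c i)⁻¹ * loopHol U c i) :=
    fun i => dist1_mul_inv_eq_rel _ _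
  simp only [e] at h
  exact h

/-- ★★ **THE RELATIVE CORRECTION FACTOR AT ONE BOND IS BOUNDED BY THE TWO NEIGHBOURHOOD SUMS**: under `PlaqSmall θ U` (the SIZE field — it alone enters the
ARC coefficient; take it to be the BACKGROUND tower's field, px12 g24 13:07:55Z FINDING «SIZE := BKG-tower») and `PlaqSmall θ₀ U₀` (guard only), `0 ≤ θ, θ₀`,
`K·θ < δ_N`, `K·θ₀ < δ_N` (`K = ((d+2)L)²∕4`; every member loop is then `≤ K·θ` resp. `≤ K·θ₀`, lit ✓`dist1_loopHol_le`),
`dist1 (κ_c(U₀)⁻¹·κ_c(U)) ≤ 3K·(Σ_{q ∈ N(c₋)} δ_q) + (3K·(2θ·(K′ + 2)))·(Σ_{b ∈ N_b(c₋)} dev_b)` (`1 + 4ρ ≤ 3` for `ρ = max(Kθ, Kθ₀) < δ_N ≤ 1∕3`; the mean of a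
constant bound is the bound; both sides symmetric in `(U, U₀)` up to `dist1_rel_comm` ∕ ✓`dist1_bdev_comm`, so either tower may carry the SIZE). [cite: Balaban1987RG1, (0.4)-(0.7) p.253; Balaban1985Averaging, (21) p.22, (26)-(27) p.22] -/
theorem dist1_corr_rel_le_nbhd_sum (hj : j + 1 ≤ P.m + P.K) (U U₀ : GaugeField P j (Matrix.specialUnitaryGroup n ℂ)) {θ θ₀ : ℝ} (hθ0 : 0 ≤ θ)
    (hθ₀0 : 0 ≤ θ₀) (hU : PlaqSmall θ U) (hU₀ : PlaqSmall θ₀ U₀) (hθN : ((((P.d + 2) * P.L : ℕ) : ℝ) ^ 2 / 4) * θ < deltaSU n)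
    (hθ₀N : ((((P.d + 2) * P.L : ℕ) : ℝ) ^ 2 / 4) * θ₀ < deltaSU n) (c : PBond P (j + 1)) :
    dist1 ((corr (expMeanLogSU (n := n)) U₀ c)⁻¹ * corr (expMeanLogSU (n := n)) U c) ≤
      (3 * (((((P.d + 2) * P.L : ℕ) : ℝ) ^ 2 / 4))) *
          ∑ q ∈ Finset.univ.filter (fun q : Plaq P j => ∀ κ, blockOf q.src κ = c.src κ ∨ blockOf q.src κ = c.src κ + 1 ∨
            blockOf q.src κ = c.src κ - 1), dist1 ((GaugeField.plaqHol U₀ q)⁻¹ * GaugeField.plaqHol U q) +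
        (3 * ((((P.d + 2) * P.L : ℕ) : ℝ) ^ 2 / 4 * (2 * θ * ((((P.d + 2) * P.L : ℕ) : ℝ) + 2)))) *
          ∑ b ∈ Finset.univ.filter (fun b : PBond P j => ∀ κ, blockOf b.src κ = c.src κ ∨ blockOf b.src κ = c.src κ + 1 ∨
            blockOf b.src κ = c.src κ - 1), dist1 (bdev U U₀ b) := by
  set K : ℝ := (((P.d + 2) * P.L : ℕ) : ℝ) ^ 2 / 4 with hKdef
  set SP := ∑ q ∈ Finset.univ.filter (fun q : Plaq P j => ∀ κ, blockOf q.src κ = c.src κ ∨ blockOf q.src κ = c.src κ + 1 ∨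
        blockOf q.src κ = c.src κ - 1), dist1 ((GaugeField.plaqHol U₀ q)⁻¹ * GaugeField.plaqHol U q) with hSP
  set SB := ∑ b ∈ Finset.univ.filter (fun b : PBond P j => ∀ κ, blockOf b.src κ = c.src κ ∨ blockOf b.src κ = c.src κ + 1 ∨
        blockOf b.src κ = c.src κ - 1), dist1 (bdev U U₀ b) with hSB
  have hK0 : 0 ≤ K := by positivity
  have hSP0 : 0 ≤ SP := Finset.sum_nonneg fun _ _ => GaugeGroup.dist1_nonneg _
  have hSB0 : 0 ≤ SB := Finset.sum_nonneg fun _ _ => GaugeGroup.dist1_nonneg _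
  -- the guard: every member loop of `U` is `≤ K·θ`, of `U₀` is `≤ K·θ₀`, both `≤ ρ := max (Kθ) (Kθ₀) < δ_N`
  set ρ := max (K * θ) (K * θ₀) with hρdef
  have hρN : ρ < deltaSU n := max_lt hθN hθ₀N
  have hW : ∀ i, dist1 (loopHol U c i) ≤ ρ := fun i => (LatticeWordStokes.dist1_loopHol_le hθ0 hU c i).trans (le_max_left _ _)
  have hW₀ : ∀ i, dist1 (loopHol U₀ c i) ≤ ρ := fun i => (LatticeWordStokes.dist1_loopHol_le hθ₀0 hU₀ c i).trans (le_max_right _ _)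
  have h0 := dist1_corr_rel_le_mean U U₀ c hρN hW hW₀
  -- each relative member loop by §2
  have hmem : ∀ i, dist1 ((loopHol U₀ c i)⁻¹ * loopHol U c i) ≤ K * SP + (K * (2 * θ * ((((P.d + 2) * P.L : ℕ) : ℝ) + 2))) * SB :=
    fun i => dist1_loopHol_rel_le_nbhd_sum dist1_comm_le_SU hj U U₀ hθ0 hU c i
  have hB0 : 0 ≤ K * SP + (K * (2 * θ * ((((P.d + 2) * P.L : ℕ) : ℝ) + 2))) * SB := by positivity
  have hcard : (0 : ℝ) < (Fintype.card (Idx P) : ℝ) := by exact_mod_cast Fintype.card_pos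
  have hmean : ((Fintype.card (Idx P) : ℝ))⁻¹ * ∑ i, dist1 ((loopHol U₀ c i)⁻¹ * loopHol U c i) ≤
      K * SP + (K * (2 * θ * ((((P.d + 2) * P.L : ℕ) : ℝ) + 2))) * SB := by
    rw [inv_mul_le_iff₀ hcard]
    calc ∑ i, dist1 ((loopHol U₀ c i)⁻¹ * loopHol U c i) ≤ ∑ _i : Idx P, (K * SP + (K * (2 * θ * ((((P.d + 2) * P.L : ℕ) : ℝ) + 2))) * SB) :=
          Finset.sum_le_sum fun i _ => hmem i
      _ = (Fintype.card (Idx P) : ℝ) * (K * SP + (K * (2 * θ * ((((P.d + 2) * P.L : ℕ) : ℝ) + 2))) * SB) := by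
          rw [Finset.sum_const, Finset.card_univ, nsmul_eq_mul]
  -- `1 + 4ρ ≤ 3`
  have hρ3 : 1 + 4 * ρ ≤ 3 := by
    have := lt_third_of_lt_deltaSU hρN
    linarith
  calc dist1 ((corr (expMeanLogSU (n := n)) U₀ c)⁻¹ * corr (expMeanLogSU (n := n)) U c)
      ≤ (1 + 4 * ρ) * (((Fintype.card (Idx P) : ℝ))⁻¹ * ∑ i, dist1 ((loopHol U₀ c i)⁻¹ * loopHol U c i)) := h0
    _ ≤ 3 * (K * SP + (K * (2 * θ * ((((P.d + 2) * P.L : ℕ) : ℝ) + 2))) * SB) :=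
        mul_le_mul hρ3 hmean (mul_nonneg (inv_nonneg.mpr hcard.le) (Finset.sum_nonneg fun _ _ => GaugeGroup.dist1_nonneg _)) (by norm_num)
    _ = 3 * K * SP + 3 * (K * (2 * θ * ((((P.d + 2) * P.L : ℕ) : ℝ) + 2))) * SB := by ring

/-! ## §4 THE LETTER: the relative correction factor in `ℓ²` over all coarse bonds -/

set_option maxHeartbeats 400000 in
/-- ★★★ **(F4-rel) THE TWO-FIELD CORRECTION-FACTOR LETTER IN ℓ²** («corr-rel», UV3-NODE §84.4 (H♭)(iii)): under `PlaqSmall θ U` (SIZE field), `PlaqSmall θ₀ U₀` (guard),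
`0 ≤ θ, θ₀`, `K·θ < δ_N`, `K·θ₀ < δ_N`,
`√(Σ_{c : PBond_{j+1}} dist1 (κ_c(U₀)⁻¹·κ_c(U))²) ≤ 3K·√((3^dL^dd²)(3^dd))·√(Σ_q δ_q²) + (3K·(2θ(K′+2)))·√((3^dL^dd)(3^dd))·√(Σ_b dev_b²)` (`K = ((d+2)L)²∕4`, `K′ = (d+2)L`,
`δ_q = dist1 (U₀(∂q)⁻¹·U(∂q))`, `dev_b = dist1 (U₀(b)⁻¹·U(b))`) — one level; every term vanishes at `U = U₀`; constants polynomial in `L`; the `θ`-weighted `dev` term is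
the same-level SIZE × ARC junk of §84.4 (v). [cite: Balaban1987RG1, (0.4) p.253; Balaban1985Averaging, (19)-(21) pp.21-22] -/
theorem sqrt_sum_dist1_corr_rel_sq_le (hj : j + 1 ≤ P.m + P.K) (U U₀ : GaugeField P j (Matrix.specialUnitaryGroup n ℂ)) {θ θ₀ : ℝ} (hθ0 : 0 ≤ θ)
    (hθ₀0 : 0 ≤ θ₀) (hU : PlaqSmall θ U) (hU₀ : PlaqSmall θ₀ U₀) (hθN : ((((P.d + 2) * P.L : ℕ) : ℝ) ^ 2 / 4) * θ < deltaSU n)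
    (hθ₀N : ((((P.d + 2) * P.L : ℕ) : ℝ) ^ 2 / 4) * θ₀ < deltaSU n) :
    √(∑ c : PBond P (j + 1), dist1 ((corr (expMeanLogSU (n := n)) U₀ c)⁻¹ * corr (expMeanLogSU (n := n)) U c) ^ 2) ≤
      (3 * (((((P.d + 2) * P.L : ℕ) : ℝ) ^ 2 / 4))) * √(((3 ^ P.d * P.L ^ P.d * P.d ^ 2 : ℕ) : ℝ) * ((3 ^ P.d * P.d : ℕ) : ℝ)) *
          √(∑ q : Plaq P j, dist1 ((GaugeField.plaqHol U₀ q)⁻¹ * GaugeField.plaqHol U q) ^ 2) +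
        (3 * ((((P.d + 2) * P.L : ℕ) : ℝ) ^ 2 / 4 * (2 * θ * ((((P.d + 2) * P.L : ℕ) : ℝ) + 2)))) *
            √(((3 ^ P.d * P.L ^ P.d * P.d : ℕ) : ℝ) * ((3 ^ P.d * P.d : ℕ) : ℝ)) *
          √(∑ b : PBond P j, dist1 (bdev U U₀ b) ^ 2) := by
  classical
  -- pointwise split (§3), then Minkowski, then the two Schur counts
  set A : PBond P (j + 1) → ℝ := fun c => (3 * (((((P.d + 2) * P.L : ℕ) : ℝ) ^ 2 / 4))) *
      ∑ q ∈ Finset.univ.filter (fun q : Plaq P j => ∀ κ, blockOf q.src κ = c.src κ ∨ blockOf q.src κ = c.src κ + 1 ∨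
        blockOf q.src κ = c.src κ - 1), dist1 ((GaugeField.plaqHol U₀ q)⁻¹ * GaugeField.plaqHol U q) with hA
  set B : PBond P (j + 1) → ℝ := fun c => (3 * ((((P.d + 2) * P.L : ℕ) : ℝ) ^ 2 / 4 * (2 * θ * ((((P.d + 2) * P.L : ℕ) : ℝ) + 2)))) *
      ∑ b ∈ Finset.univ.filter (fun b : PBond P j => ∀ κ, blockOf b.src κ = c.src κ ∨ blockOf b.src κ = c.src κ + 1 ∨
        blockOf b.src κ = c.src κ - 1), dist1 (bdev U U₀ b) with hB
  have hsplit := sqrt_sum_sq_le_of_le_add (Finset.univ : Finset (PBond P (j + 1)))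
    (fun c => dist1 ((corr (expMeanLogSU (n := n)) U₀ c)⁻¹ * corr (expMeanLogSU (n := n)) U c)) A B
    (fun c _ => GaugeGroup.dist1_nonneg _) (fun c _ => dist1_corr_rel_le_nbhd_sum hj U U₀ hθ0 hθ₀0 hU hU₀ hθN hθ₀N c)
  have hAle := sqrt_sum_sq_le_of_le_bond_nbhd_sum hj (fun q : Plaq P j => dist1 ((GaugeField.plaqHol U₀ q)⁻¹ * GaugeField.plaqHol U q)) A
    (c := 3 * (((((P.d + 2) * P.L : ℕ) : ℝ) ^ 2 / 4))) (by positivity)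
    (fun c => by rw [hA]; exact mul_nonneg (by positivity) (Finset.sum_nonneg fun _ _ => GaugeGroup.dist1_nonneg _)) (fun c => le_rfl)
  have hBle := sqrt_sum_sq_le_of_le_bond_bond_nbhd_sum hj (fun b : PBond P j => dist1 (bdev U U₀ b)) B
    (c := 3 * ((((P.d + 2) * P.L : ℕ) : ℝ) ^ 2 / 4 * (2 * θ * ((((P.d + 2) * P.L : ℕ) : ℝ) + 2)))) (by positivity)
    (fun c => by rw [hB]; exact mul_nonneg (by positivity) (Finset.sum_nonneg fun _ _ => GaugeGroup.dist1_nonneg _)) (fun c => le_rfl)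
  exact hsplit.trans (add_le_add hAle hBle)

/-! ## §5 The SPINE edition — the two-tower `hF4`-rel binder -/

/-- ★★★ **(F4-rel) IN SPINE CURRENCY, px10's orientation**: if the coarse fields `V, V₀` have the straight rows of the (0.4) averages of `W, W₀` (`T_c(V) = ū_c(W)`,
`T_c(V₀) = ū_c(W₀)` — for the two stage towers: `V = lift ū(U′)`, `V₀ = lift ū(U′₀)`, by (T5) + ✓`axialAvg_lift`), then under the same guard
`√(Σ_c dist1 ((T_c(W₀)·T_c(V₀)⁻¹)⁻¹·(T_c(W)·T_c(V)⁻¹))²) ≤` the right side of ✓`sqrt_sum_dist1_corr_rel_sq_le` — the spine flaps ARE the inverse correction factors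
(✓(b3) `axialAvg_mul_avgFun_inv`), and `dist1 ((κ₀⁻¹)⁻¹·κ⁻¹) = dist1 (κ₀⁻¹·κ)`. [cite: Balaban1987RG1, (0.4) p.253; Balaban1985Averaging, (19)-(21) pp.21-22] -/
theorem sqrt_sum_dist1_spine_rel_sq_le (hj : j + 1 ≤ P.m + P.K) (W W₀ V V₀ : GaugeField P j (Matrix.specialUnitaryGroup n ℂ))
    (havg : ∀ c : PBond P (j + 1), AveragingRT.axialAvg V c = avgFun (expMeanLogSU (n := n)) W c)
    (havg₀ : ∀ c : PBond P (j + 1), AveragingRT.axialAvg V₀ c = avgFun (expMeanLogSU (n := n)) W₀ c) {θ θ₀ : ℝ} (hθ0 : 0 ≤ θ) (hθ₀0 : 0 ≤ θ₀)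
    (hW : PlaqSmall θ W) (hW₀ : PlaqSmall θ₀ W₀) (hθN : ((((P.d + 2) * P.L : ℕ) : ℝ) ^ 2 / 4) * θ < deltaSU n)
    (hθ₀N : ((((P.d + 2) * P.L : ℕ) : ℝ) ^ 2 / 4) * θ₀ < deltaSU n) :
    √(∑ c : PBond P (j + 1), dist1 ((AveragingRT.axialAvg W₀ c * (AveragingRT.axialAvg V₀ c)⁻¹)⁻¹ *
        (AveragingRT.axialAvg W c * (AveragingRT.axialAvg V c)⁻¹)) ^ 2) ≤
      (3 * (((((P.d + 2) * P.L : ℕ) : ℝ) ^ 2 / 4))) * √(((3 ^ P.d * P.L ^ P.d * P.d ^ 2 : ℕ) : ℝ) * ((3 ^ P.d * P.d : ℕ) : ℝ)) *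
          √(∑ q : Plaq P j, dist1 ((GaugeField.plaqHol W₀ q)⁻¹ * GaugeField.plaqHol W q) ^ 2) +
        (3 * ((((P.d + 2) * P.L : ℕ) : ℝ) ^ 2 / 4 * (2 * θ * ((((P.d + 2) * P.L : ℕ) : ℝ) + 2)))) *
            √(((3 ^ P.d * P.L ^ P.d * P.d : ℕ) : ℝ) * ((3 ^ P.d * P.d : ℕ) : ℝ)) *
          √(∑ b : PBond P j, dist1 (bdev W W₀ b) ^ 2) := by
  have e : ∀ c : PBond P (j + 1), dist1 ((AveragingRT.axialAvg W₀ c * (AveragingRT.axialAvg V₀ c)⁻¹)⁻¹ *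
      (AveragingRT.axialAvg W c * (AveragingRT.axialAvg V c)⁻¹)) =
        dist1 ((corr (expMeanLogSU (n := n)) W₀ c)⁻¹ * corr (expMeanLogSU (n := n)) W c) := by
    intro c
    rw [havg c, havg₀ c, axialAvg_mul_avgFun_inv, axialAvg_mul_avgFun_inv, inv_inv, dist1_mul_inv_eq_rel, dist1_rel_comm]
  simp only [e]
  exact sqrt_sum_dist1_corr_rel_sq_le hj W W₀ hθ0 hθ₀0 hW hW₀ hθN hθ₀N

/-- ★★★ **(F4-rel) IN SPINE CURRENCY, px12's chord orientation** `dist1 (X·X₀⁻¹)` (`X = T_c(W)·T_c(V)⁻¹`, `X₀ = T_c(W₀)·T_c(V₀)⁻¹`): the same bound.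
[cite: Balaban1987RG1, (0.4) p.253; Balaban1985Averaging, (19)-(21) pp.21-22] -/
theorem sqrt_sum_dist1_spine_rel_sq_le' (hj : j + 1 ≤ P.m + P.K) (W W₀ V V₀ : GaugeField P j (Matrix.specialUnitaryGroup n ℂ))
    (havg : ∀ c : PBond P (j + 1), AveragingRT.axialAvg V c = avgFun (expMeanLogSU (n := n)) W c)
    (havg₀ : ∀ c : PBond P (j + 1), AveragingRT.axialAvg V₀ c = avgFun (expMeanLogSU (n := n)) W₀ c) {θ θ₀ : ℝ} (hθ0 : 0 ≤ θ) (hθ₀0 : 0 ≤ θ₀)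
    (hW : PlaqSmall θ W) (hW₀ : PlaqSmall θ₀ W₀) (hθN : ((((P.d + 2) * P.L : ℕ) : ℝ) ^ 2 / 4) * θ < deltaSU n)
    (hθ₀N : ((((P.d + 2) * P.L : ℕ) : ℝ) ^ 2 / 4) * θ₀ < deltaSU n) :
    √(∑ c : PBond P (j + 1), dist1 ((AveragingRT.axialAvg W c * (AveragingRT.axialAvg V c)⁻¹) *
        (AveragingRT.axialAvg W₀ c * (AveragingRT.axialAvg V₀ c)⁻¹)⁻¹) ^ 2) ≤
      (3 * (((((P.d + 2) * P.L : ℕ) : ℝ) ^ 2 / 4))) * √(((3 ^ P.d * P.L ^ P.d * P.d ^ 2 : ℕ) : ℝ) * ((3 ^ P.d * P.d : ℕ) : ℝ)) *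
          √(∑ q : Plaq P j, dist1 ((GaugeField.plaqHol W₀ q)⁻¹ * GaugeField.plaqHol W q) ^ 2) +
        (3 * ((((P.d + 2) * P.L : ℕ) : ℝ) ^ 2 / 4 * (2 * θ * ((((P.d + 2) * P.L : ℕ) : ℝ) + 2)))) *
            √(((3 ^ P.d * P.L ^ P.d * P.d : ℕ) : ℝ) * ((3 ^ P.d * P.d : ℕ) : ℝ)) *
          √(∑ b : PBond P j, dist1 (bdev W W₀ b) ^ 2) := by
  simp only [dist1_mul_inv_eq_rel]
  exact sqrt_sum_dist1_spine_rel_sq_le hj W W₀ V V₀ havg havg₀ hθ0 hθ₀0 hW hW₀ hθN hθ₀N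

end SUN

end Summit.QuantumFields.YangMills.Theorems.FluctuationComparisonRegPrIntLS2BetaCorrLetterL2Relative

end
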